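import Mathlib.AlgebraicGeometry.Modules.Sheaf
import Mathlib.AlgebraicGeometry.AffineScheme
import Mathlib.Topology.Sheaves.SheafCondition.UniqueGluing
import HarnessLib

/-!
# [OURS · L1 W4.5(b) · EL♮(3) · J1c B6 brick F2] Sections of a sheaf of modules over `g⁻¹Ω` glue uniquely from a compatible family on
# the charts below `Ω`
Crux chain w45b, child EL♮(3) = stmt-ResolutionOfSingularities-20148; J1c = the tree-proof programme for the NEED-FACT
`EmbeddedInfinitesimalLiftFact`; brick F2 of res-type-027 g17's (π) patching-engine split (STATUS l.78813, 2026-08-28T05:26:17Z), dealt to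
res-L1-w45b-lead-1 g12 by res-L1-w45b-plan-1 RULING R11 (ii); signatures `L/res-L1-w45b-lead-1/F2-SectionsGlueAffineCharts.sig.lean`
sha16 639af70836d9b756.

For a morphism of schemes `g : Y ⟶ X`, a sheaf of `𝒪_Y`-modules `M`, an open `Ω ⊆ X` and a predicate `P` of «charts» on the opens of `X`
that form a BASIS of the opens below `Ω` (`hbasis`; F6's charts = affine opens of `W_{n+1}` whose special-fibre trace lies in an lci chart —
downward closed among affine opens, hence a basis):

* `section_eq_of_forall_map_chart_eq` — two sections of `M` over `g⁻¹Ω` agreeing on `g⁻¹U` for every chart `U ≤ Ω` are equal;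
* `existsUnique_section_of_chart_family` — a family `s U ∈ Γ(M, g⁻¹U)` on the charts `U ≤ Ω`, compatible under restriction along chart
  INCLUSIONS `U' ≤ U` only, is the family of restrictions of a unique `t ∈ Γ(M, g⁻¹Ω)` (sheaf axiom of `M` on the cover `{g⁻¹U}`; the
  pairwise compatibility on `g⁻¹U ∩ g⁻¹U'` is recovered on the charts inside `U ∩ U'` — NO affine-intersection hypothesis);
* corollaries `existsUnique_section_of_affine_chart_family` (charts = affine opens with a side condition `Q` downward closed among affine
  sub-opens; only the cover of `Ω` is assumed) and `existsUnique_section_of_affine_family` (all affine opens below `Ω`, no hypothesis).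

For `M = normalSheaf ι` the restriction maps are `restrictHom` (`normalSheaf_presheaf_map`, p606867, `rfl`). Everything is proved; DEF-FREE;
no `sorry`; standard axioms; pure Mathlib imports. OURS; NOT a statement of any manuscript; AI-written, weaker than expert review.
`--supports stmt-ResolutionOfSingularities-20148 --as helper`. [cite: Hartshorne1977, II.1 (sheaf axioms) and II Ex. 1.22 (glueing)] (index only).
-/

set_option linter.dupNamespace false -- mandated namespace `Summit.<Summit>.<Problem>` of this single-conjunct summit

noncomputable section

open CategoryTheory AlgebraicGeometry TopologicalSpace Opposite

namespace Summit.ResolutionOfSingularities.ResolutionOfSingularities.Cruxes.EquisingularLiftNat.Sections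

universe u

variable {X Y : Scheme.{u}} (g : Y ⟶ X) (M : Y.Modules)

/-- Restricting twice is restricting once, with the composite inclusion named freely (inclusions of opens are unique). [folklore] -/
theorem presheaf_map_map_of_hom {A B C : Y.Opens} (a : A ⟶ B) (b : B ⟶ C) (c : A ⟶ C) (x : Γ(M, C)) :
    M.presheaf.map a.op (M.presheaf.map b.op x) = M.presheaf.map c.op x := by
  rw [Subsingleton.elim c (a ≫ b), op_comp, Functor.map_comp]
  rfl

/-- The preimages of a basis of charts below `V` cover `g⁻¹V`. [folklore] -/
theorem preimage_le_iSup_preimage_charts (P : X.Opens → Prop) (V : X.Opens)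
    (hV : ∀ x ∈ V, ∃ U, P U ∧ x ∈ U ∧ U ≤ V) :
    g ⁻¹ᵁ V ≤ ⨆ U : {U : X.Opens // P U ∧ U ≤ V}, g ⁻¹ᵁ U.1 := fun y hy => by
  obtain ⟨U, hPU, hyU, hUV⟩ := hV (g.base y) hy
  exact Opens.mem_iSup.mpr ⟨⟨U, hPU, hUV⟩, hyU⟩

/-- **F2 (uniqueness half)**: two sections of `M` over `g⁻¹Ω` that agree on `g⁻¹U` for every chart `U ≤ Ω` of a basis of charts below `Ω`
are equal. [folklore] -/
theorem section_eq_of_forall_map_chart_eq (P : X.Opens → Prop) (Ω : X.Opens)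
    (hbasis : ∀ (V : X.Opens), V ≤ Ω → ∀ x ∈ V, ∃ U, P U ∧ x ∈ U ∧ U ≤ V)
    (t t' : Γ(M, g ⁻¹ᵁ Ω))
    (h : ∀ (U : X.Opens) (_ : P U) (hU : U ≤ Ω),
      M.presheaf.map (homOfLE (g.preimage_mono hU)).op t = M.presheaf.map (homOfLE (g.preimage_mono hU)).op t') :
    t = t' :=
  TopCat.Sheaf.eq_of_locally_eq' ((SheafOfModules.toSheaf Y.ringCatSheaf).obj M)
    (fun U : {U : X.Opens // P U ∧ U ≤ Ω} => g ⁻¹ᵁ U.1) (g ⁻¹ᵁ Ω) (fun U => homOfLE (g.preimage_mono U.2.2))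
    (preimage_le_iSup_preimage_charts g P Ω (hbasis Ω le_rfl)) t t' fun U => h U.1 U.2.1 U.2.2

/-- **F2 — sections glue uniquely from a compatible family on the charts below `Ω`**: for a predicate `P` of «charts» forming a basis of
the opens below `Ω` (`hbasis`), a family of sections `s U ∈ Γ(M, g⁻¹U)` on the charts `U ≤ Ω`, compatible under restriction along chart
inclusions `U' ≤ U`, is the family of restrictions of a unique section over `g⁻¹Ω`. [folklore] -/
theorem existsUnique_section_of_chart_family (P : X.Opens → Prop) (Ω : X.Opens)
    (hbasis : ∀ (V : X.Opens), V ≤ Ω → ∀ x ∈ V, ∃ U, P U ∧ x ∈ U ∧ U ≤ V)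
    (s : ∀ (U : X.Opens), P U → U ≤ Ω → Γ(M, g ⁻¹ᵁ U))
    (hs : ∀ (U U' : X.Opens) (hU : P U) (hU' : P U') (hUΩ : U ≤ Ω) (hU'Ω : U' ≤ Ω) (k : U' ≤ U),
      M.presheaf.map (homOfLE (g.preimage_mono k)).op (s U hU hUΩ) = s U' hU' hU'Ω) :
    ∃! t : Γ(M, g ⁻¹ᵁ Ω), ∀ (U : X.Opens) (hU : P U) (hUΩ : U ≤ Ω),
      M.presheaf.map (homOfLE (g.preimage_mono hUΩ)).op t = s U hU hUΩ := by
  -- the cover of `g⁻¹Ω` by the preimages of the charts below `Ω`, and the family on it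
  let F := (SheafOfModules.toSheaf Y.ringCatSheaf).obj M
  let W : {U : X.Opens // P U ∧ U ≤ Ω} → Y.Opens := fun U => g ⁻¹ᵁ U.1
  let sf : ∀ U : {U : X.Opens // P U ∧ U ≤ Ω}, Γ(M, W U) := fun U => s U.1 U.2.1 U.2.2
  -- pairwise compatibility on `g⁻¹U ∩ g⁻¹U'`, checked on the charts inside `U ∩ U'`
  have hcompat : ∀ i j : {U : X.Opens // P U ∧ U ≤ Ω},
      M.presheaf.map (Opens.infLELeft (W i) (W j)).op (sf i) = M.presheaf.map (Opens.infLERight (W i) (W j)).op (sf j) := by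
    intro i j
    have hk : ∀ k : {U : X.Opens // P U ∧ U ≤ i.1 ⊓ j.1}, g ⁻¹ᵁ k.1 ≤ W i ⊓ W j := fun k =>
      le_inf (g.preimage_mono (k.2.2.trans inf_le_left)) (g.preimage_mono (k.2.2.trans inf_le_right))
    have hcov : W i ⊓ W j ≤ ⨆ k : {U : X.Opens // P U ∧ U ≤ i.1 ⊓ j.1}, g ⁻¹ᵁ k.1 := fun y hy => by
      obtain ⟨hyi, hyj⟩ := Opens.mem_inf.mp hy
      exact preimage_le_iSup_preimage_charts g P (i.1 ⊓ j.1) (hbasis (i.1 ⊓ j.1) (inf_le_left.trans i.2.2))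
        (show g.base y ∈ i.1 ⊓ j.1 from Opens.mem_inf.mpr ⟨hyi, hyj⟩)
    refine TopCat.Sheaf.eq_of_locally_eq' F (fun k : {U : X.Opens // P U ∧ U ≤ i.1 ⊓ j.1} => g ⁻¹ᵁ k.1)
      (W i ⊓ W j) (fun k => homOfLE (hk k)) hcov _ _ fun k => ?_
    show M.presheaf.map (homOfLE (hk k)).op (M.presheaf.map (Opens.infLELeft (W i) (W j)).op (sf i)) =
      M.presheaf.map (homOfLE (hk k)).op (M.presheaf.map (Opens.infLERight (W i) (W j)).op (sf j))
    have hki : k.1 ≤ i.1 := k.2.2.trans inf_le_left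
    have hkj : k.1 ≤ j.1 := k.2.2.trans inf_le_right
    rw [presheaf_map_map_of_hom M _ _ (homOfLE (g.preimage_mono hki)),
      presheaf_map_map_of_hom M _ _ (homOfLE (g.preimage_mono hkj))]
    exact (hs i.1 k.1 i.2.1 k.2.1 i.2.2 (hki.trans i.2.2) hki).trans
      (hs j.1 k.1 j.2.1 k.2.1 j.2.2 (hkj.trans j.2.2) hkj).symm
  obtain ⟨t, ht, huniq⟩ := TopCat.Sheaf.existsUnique_gluing' F W (g ⁻¹ᵁ Ω)
    (fun U => homOfLE (g.preimage_mono U.2.2)) (preimage_le_iSup_preimage_charts g P Ω (hbasis Ω le_rfl)) sf hcompat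
  exact ⟨t, fun U hU hUΩ => ht ⟨U, hU, hUΩ⟩, fun t' ht' => huniq t' fun U => ht' U.1 U.2.1 U.2.2⟩

/-- **F2, affine charts with a downward-closed side condition** (`Q U → U' ≤ U → U' affine → Q U'`; e.g. «the trace of `U` on `W₀` lies in
an lci chart»): compatible sections on the affine `Q`-opens below `Ω` (assumed to cover `Ω`) glue uniquely over `g⁻¹Ω`. [folklore] -/
theorem existsUnique_section_of_affine_chart_family (Q : X.Opens → Prop)
    (hQ : ∀ (U U' : X.Opens), Q U → U' ≤ U → IsAffineOpen U' → Q U') (Ω : X.Opens)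
    (hcov : ∀ x ∈ Ω, ∃ U : X.Opens, IsAffineOpen U ∧ Q U ∧ x ∈ U ∧ U ≤ Ω)
    (s : ∀ (U : X.Opens), IsAffineOpen U → Q U → U ≤ Ω → Γ(M, g ⁻¹ᵁ U))
    (hs : ∀ (U U' : X.Opens) (hU : IsAffineOpen U) (hQU : Q U) (hU' : IsAffineOpen U') (hQU' : Q U') (hUΩ : U ≤ Ω)
      (hU'Ω : U' ≤ Ω) (k : U' ≤ U), M.presheaf.map (homOfLE (g.preimage_mono k)).op (s U hU hQU hUΩ) = s U' hU' hQU' hU'Ω) :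
    ∃! t : Γ(M, g ⁻¹ᵁ Ω), ∀ (U : X.Opens) (hU : IsAffineOpen U) (hQU : Q U) (hUΩ : U ≤ Ω),
      M.presheaf.map (homOfLE (g.preimage_mono hUΩ)).op t = s U hU hQU hUΩ := by
  -- the affine `Q`-opens form a basis below `Ω`: refine an affine `Q`-chart through `x` by a smaller affine open inside `V`
  have hbasis : ∀ (V : X.Opens), V ≤ Ω → ∀ x ∈ V, ∃ U, (IsAffineOpen U ∧ Q U) ∧ x ∈ U ∧ U ≤ V := by
    intro V hV x hx
    obtain ⟨U, hU, hQU, hxU, -⟩ := hcov x (hV hx)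
    obtain ⟨_, ⟨U', hU', rfl⟩, hxU', hU'le⟩ :=
      X.isBasis_affineOpens.exists_subset_of_mem_open (show x ∈ (U ⊓ V : X.Opens) from ⟨hxU, hx⟩) (U ⊓ V).isOpen
    exact ⟨U', ⟨hU', hQ U U' hQU (fun y hy => (hU'le hy).1) hU'⟩, hxU', fun y hy => (hU'le hy).2⟩
  obtain ⟨t, ht, huniq⟩ := existsUnique_section_of_chart_family g M (fun U => IsAffineOpen U ∧ Q U) Ω hbasis
    (fun U hU hUΩ => s U hU.1 hU.2 hUΩ) (fun U U' hU hU' hUΩ hU'Ω k => hs U U' hU.1 hU.2 hU'.1 hU'.2 hUΩ hU'Ω k)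
  exact ⟨t, fun U hU hQU hUΩ => ht U ⟨hU, hQU⟩ hUΩ, fun t' ht' => huniq t' fun U hU hUΩ => ht' U hU.1 hU.2 hUΩ⟩

/-- **F2, all affine charts**: compatible sections on the affine opens below `Ω` glue uniquely over `g⁻¹Ω`. [folklore] -/
theorem existsUnique_section_of_affine_family (Ω : X.Opens)
    (s : ∀ (U : X.Opens), IsAffineOpen U → U ≤ Ω → Γ(M, g ⁻¹ᵁ U))
    (hs : ∀ (U U' : X.Opens) (hU : IsAffineOpen U) (hU' : IsAffineOpen U') (hUΩ : U ≤ Ω) (hU'Ω : U' ≤ Ω) (k : U' ≤ U),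
      M.presheaf.map (homOfLE (g.preimage_mono k)).op (s U hU hUΩ) = s U' hU' hU'Ω) :
    ∃! t : Γ(M, g ⁻¹ᵁ Ω), ∀ (U : X.Opens) (hU : IsAffineOpen U) (hUΩ : U ≤ Ω),
      M.presheaf.map (homOfLE (g.preimage_mono hUΩ)).op t = s U hU hUΩ := by
  have hcov : ∀ x ∈ Ω, ∃ U : X.Opens, IsAffineOpen U ∧ True ∧ x ∈ U ∧ U ≤ Ω := by
    intro x hx
    obtain ⟨_, ⟨U, hU, rfl⟩, hxU, hUle⟩ := X.isBasis_affineOpens.exists_subset_of_mem_open hx Ω.isOpen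
    exact ⟨U, hU, trivial, hxU, hUle⟩
  obtain ⟨t, ht, huniq⟩ := existsUnique_section_of_affine_chart_family g M (fun _ => True)
    (fun _ _ _ _ _ => trivial) Ω hcov (fun U hU _ hUΩ => s U hU hUΩ)
    (fun U U' hU _ hU' _ hUΩ hU'Ω k => hs U U' hU hU' hUΩ hU'Ω k)
  exact ⟨t, fun U hU hUΩ => ht U hU trivial hUΩ, fun t' ht' => huniq t' fun U hU _ hUΩ => ht' U hU hUΩ⟩

/-- **F2, uniqueness on all affine charts**: two sections over `g⁻¹Ω` agreeing on `g⁻¹U` for every affine `U ≤ Ω` are equal.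
[folklore] -/
theorem section_eq_of_forall_map_affine_eq (Ω : X.Opens) (t t' : Γ(M, g ⁻¹ᵁ Ω))
    (h : ∀ (U : X.Opens) (_ : IsAffineOpen U) (hU : U ≤ Ω),
      M.presheaf.map (homOfLE (g.preimage_mono hU)).op t = M.presheaf.map (homOfLE (g.preimage_mono hU)).op t') :
    t = t' := by
  obtain ⟨_, -, huniq⟩ := existsUnique_section_of_affine_family g M Ω
    (fun U _ hUΩ => M.presheaf.map (homOfLE (g.preimage_mono hUΩ)).op t')
    (fun U U' _ _ hUΩ hU'Ω k => presheaf_map_map_of_hom M _ _ _ t')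
  exact (huniq t fun U hU hUΩ => h U hU hUΩ).trans (huniq t' fun _ _ _ => rfl).symm

end Summit.ResolutionOfSingularities.ResolutionOfSingularities.Cruxes.EquisingularLiftNat.Sections

end
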